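import Mathlib
import Summits.ValiantsHypothesis.ValiantsHypothesis.Theorems.NewtonUnitEquationsTwoProductsFormalLogLinearisationDefs
import Summits.ValiantsHypothesis.ValiantsHypothesis.Theorems.NewtonUnitEquationsTwoProductsPlanarCrossCount
import Summits.ValiantsHypothesis.ValiantsHypothesis.Theorems.TwoProducts.Negative.RowCoincidenceThreeDigitBox
import Summits.ValiantsHypothesis.ValiantsHypothesis.Theorems.TwoProducts.Negative.RowRigiditySquareDifference
import HarnessLib

/-!
# A third exception to box row-coincidence: an exceptional LL-visible corner WITHOUT its half letter (`m = 3`)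

Negative lane, `--supports stmt-ValiantsHypothesis-5906` (route `NewtonUnitEquations`, crux `TwoProducts`, line
`relation_ladder`; ideas `subbox-congruence-cascade`, `CornerSqueeze`). No summit statement is proved here.

In the two accepted witnesses (`RowCoincidenceThreeDigitBox`: the top-letter pencil `E_T`; `RowRigiditySquareDifference`:
the square difference) and in every `m = 2` exception, the exceptional LL-visible corner `p = (8,8)` is paid for by its
HALF LETTER `T = (4,4) = p/2`, which occurs in some row (for `m = 2` this is forced: `(8,8)` is a sum of two digit letters
only as `T + T`). The typed charging law «exceptional LL-visible digit corner `p = 2h` ⇒ `h` is a tail letter» is FALSE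
from `m = 3` on. With `Z := X^(1,1)`, `U := X^(2,2)`, `A := X^(2,4)`, `B := X^(4,2)` (no `T`) and the common parts
`W₁ = A − Z`, `W₂ = A − U`, `W₃ = A + Z`:

  `u = (W₁ − 2B, W₂ − 3B, W₃ − B)`,  `v = (W₁ − 3B, W₂ − B, W₃ − 2B)`,
  `∏ (1 + u_j) − ∏ (1 + v_j) = −2·X^(8,8) + 2·X^(9,5) + 4·X^(10,6)`.

So `p = (8,8)` is LL-visible (weight `ξ = (−10,−1)`), the `[0,8)²`-box below `p` is clean, the truncated rows are the
rows themselves and differ as multisets, and `T = p/2` is in NO row (`halfLetter_notMem_tailSupport`). Mechanism: the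
rows agree modulo the NON-top letter `B`, the `B`-coefficients `(−2,−3,−1)` / `(−3,−1,−2)` have equal `e₁, e₂`, and the
in-box products `B·Z, B·U = B·Z², B·U·Z, B·U²` cancel through the monomial coincidence `Z² = U` (found by hand from the
moment equations, memo `TRIPLE-34`; exact integer arithmetic). [folklore]
-/

set_option linter.dupNamespace false

open scoped BigOperators
open MvPolynomial
open Summit.ValiantsHypothesis.ValiantsHypothesis.Theorems.NewtonUnitEquations.TwoProducts.FormalLogLinearisation
open Summit.ValiantsHypothesis.ValiantsHypothesis.Theorems.NewtonUnitEquations.TwoProducts.PlanarCell (tailSupport)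
open Summit.ValiantsHypothesis.ValiantsHypothesis.Theorems.NewtonUnitEquations.TwoProducts.Negative.RowCoincidence
open Summit.ValiantsHypothesis.ValiantsHypothesis.Theorems.NewtonUnitEquations.TwoProducts.Negative.SquareDifference
  (zz z2 zz_ne_z2 zz_ne_et z2_ne_et zz_ne_pp z2_ne_pp et_ne_pp)

namespace Summit.ValiantsHypothesis.ValiantsHypothesis.Theorems.NewtonUnitEquations.TwoProducts.Negative.NoHalfLetter

noncomputable section

/-- the letter `A = (2,4)`. -/
def ya : Expo := Finsupp.single 0 2 + Finsupp.single 1 4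
/-- the letter `B = (4,2)`. -/
def xb : Expo := Finsupp.single 0 4 + Finsupp.single 1 2
/-- the outside point `(9,5) = B + B + Z`. -/
def e95 : Expo := Finsupp.single 0 9 + Finsupp.single 1 5
/-- the outside point `(10,6) = B + B + U`. -/
def e106 : Expo := Finsupp.single 0 10 + Finsupp.single 1 6

/-- distinctness of two exponents. -/
theorem zz_ne_ya : zz ≠ ya := fun h => by have := congrArg (· 0) h; simp [zz, ya] at this
/-- distinctness of two exponents. -/
theorem zz_ne_xb : zz ≠ xb := fun h => by have := congrArg (· 0) h; simp [zz, xb] at this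
/-- distinctness of two exponents. -/
theorem z2_ne_ya : z2 ≠ ya := fun h => by have := congrArg (· 1) h; simp [z2, ya] at this
/-- distinctness of two exponents. -/
theorem z2_ne_xb : z2 ≠ xb := fun h => by have := congrArg (· 0) h; simp [z2, xb] at this
/-- distinctness of two exponents. -/
theorem ya_ne_xb : ya ≠ xb := fun h => by have := congrArg (· 0) h; simp [ya, xb] at this
/-- distinctness of two exponents. -/
theorem ya_ne_et : ya ≠ et := fun h => by have := congrArg (· 0) h; simp [ya, et] at this
/-- distinctness of two exponents. -/
theorem xb_ne_et : xb ≠ et := fun h => by have := congrArg (· 1) h; simp [xb, et] at this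
/-- distinctness of two exponents. -/
theorem pp_ne_e95 : pp ≠ e95 := fun h => by have := congrArg (· 0) h; simp [pp, et, e95] at this
/-- distinctness of two exponents. -/
theorem pp_ne_e106 : pp ≠ e106 := fun h => by have := congrArg (· 0) h; simp [pp, et, e106] at this
/-- distinctness of two exponents. -/
theorem e95_ne_e106 : e95 ≠ e106 := fun h => by have := congrArg (· 0) h; simp [e95, e106] at this

/-- A four-letter row `z·Z + c·U + a·A + b·B` (no `T`). -/
def row4 (z c a b : ℂ) : MvPolynomial (Fin 2) ℂ := monomial zz z + monomial z2 c + monomial ya a + monomial xb b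

/-- Coefficients of a four-letter row. -/
theorem coeff_row4 (z c a b : ℂ) (x : Expo) :
    coeff x (row4 z c a b) =
      (if zz = x then z else 0) + (if z2 = x then c else 0) + (if ya = x then a else 0) + (if xb = x then b else 0) := by
  simp [row4, coeff_monomial]

/-- `coeff Z`. -/
@[simp] theorem coeff_row4_zz (z c a b : ℂ) : coeff zz (row4 z c a b) = z := by
  simp [coeff_row4, zz_ne_z2.symm, zz_ne_ya.symm, zz_ne_xb.symm]
/-- `coeff B`. -/
@[simp] theorem coeff_row4_xb (z c a b : ℂ) : coeff xb (row4 z c a b) = b := by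
  simp [coeff_row4, zz_ne_xb, z2_ne_xb, ya_ne_xb]
/-- `coeff T = 0`: the half letter is absent. -/
@[simp] theorem coeff_row4_et (z c a b : ℂ) : coeff et (row4 z c a b) = 0 := by
  simp [coeff_row4, zz_ne_et, z2_ne_et, ya_ne_et, xb_ne_et]

/-- A row in `C · X₀^i X₁^k` form (for `ring`). -/
theorem row4_eq (z c a b : ℂ) :
    row4 z c a b = C z * X 0 ^ 1 * X 1 ^ 1 + C c * X 0 ^ 2 * X 1 ^ 2 + C a * X 0 ^ 2 * X 1 ^ 4 + C b * X 0 ^ 4 * X 1 ^ 2 := by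
  rw [C_mul_X_eq, C_mul_X_eq, C_mul_X_eq, C_mul_X_eq]; rfl

/-- f-tails `u = (A − Z − 2B, A − U − 3B, A + Z − B)`. -/
def tu : Fin 3 → MvPolynomial (Fin 2) ℂ := ![row4 (-1) 0 1 (-2), row4 0 (-1) 1 (-3), row4 1 0 1 (-1)]

/-- g-tails `v = (A − Z − 3B, A − U − B, A + Z − 2B)`. -/
def tv : Fin 3 → MvPolynomial (Fin 2) ℂ := ![row4 (-1) 0 1 (-3), row4 0 (-1) 1 (-1), row4 1 0 1 (-2)]

/-- The tail difference is `−2·X^(8,8) + 2·X^(9,5) + 4·X^(10,6)`. -/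
theorem tailDiff_eq : tailDiff tu tv = monomial pp (-2) + monomial e95 2 + monomial e106 4 := by
  have hpp : pp = Finsupp.single 0 8 + Finsupp.single 1 8 := by
    ext i; fin_cases i <;> simp [pp, et]
  have h8 : (monomial pp (-2 : ℂ) : MvPolynomial (Fin 2) ℂ) = C (-2) * X 0 ^ 8 * X 1 ^ 8 := by
    rw [C_mul_X_eq, hpp]
  have h95 : (monomial e95 (2 : ℂ) : MvPolynomial (Fin 2) ℂ) = C 2 * X 0 ^ 9 * X 1 ^ 5 := by
    rw [C_mul_X_eq]; rfl
  have h106 : (monomial e106 (4 : ℂ) : MvPolynomial (Fin 2) ℂ) = C 4 * X 0 ^ 10 * X 1 ^ 6 := by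
    rw [C_mul_X_eq]; rfl
  simp only [tailDiff, tu, tv, Fin.prod_univ_three, Matrix.cons_val_zero, Matrix.cons_val_one, Matrix.cons_val]
  rw [h8, h95, h106, row4_eq, row4_eq, row4_eq, row4_eq, row4_eq, row4_eq]
  simp only [map_neg, map_one, map_zero, map_ofNat]
  ring

/-- Coefficients of the tail difference. -/
theorem coeff_tailDiff (x : Expo) :
    coeff x (tailDiff tu tv) = (if pp = x then (-2 : ℂ) else 0) + (if e95 = x then 2 else 0) + (if e106 = x then 4 else 0) := by
  rw [tailDiff_eq]; simp only [coeff_add, coeff_monomial]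

/-- The support of the tail difference is inside `{(8,8), (9,5), (10,6)}`. -/
theorem mem_support_tailDiff {x : Expo} (hx : x ∈ (tailDiff tu tv).support) : x = pp ∨ x = e95 ∨ x = e106 := by
  rw [mem_support_iff, coeff_tailDiff] at hx
  by_contra h
  push Not at h
  apply hx
  simp [Ne.symm h.1, Ne.symm h.2.1, Ne.symm h.2.2]

/-- `(8,8)` is in the support (coefficient `−2`). -/
theorem pp_mem_support : pp ∈ (tailDiff tu tv).support := by
  rw [mem_support_iff, coeff_tailDiff]; simp [pp_ne_e95.symm, pp_ne_e106.symm]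

/-- Support of a four-letter row. -/
theorem mem_support_row4 {z c a b : ℂ} {x : Expo} (hx : x ∈ (row4 z c a b).support) :
    x = zz ∨ x = z2 ∨ x = ya ∨ x = xb := by
  rw [mem_support_iff, coeff_row4] at hx
  by_contra h
  push Not at h
  apply hx
  simp [Ne.symm h.1, Ne.symm h.2.1, Ne.symm h.2.2.1, Ne.symm h.2.2.2]

/-- The weight `ξ = (−10, −1)`. -/
def xi2 : Fin 2 → ℝ := ![-10, -1]

/-- `ξ₀ = −10`. -/
@[simp] theorem xi2_zero : xi2 0 = -10 := rfl
/-- `ξ₁ = −1`. -/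
@[simp] theorem xi2_one : xi2 1 = -1 := rfl

/-- `wt ξ e = −(10 e₀ + e₁)`. -/
theorem wt_xi2 (e : Expo) : wt xi2 e = -(10 * ((e 0 : ℕ) : ℝ) + ((e 1 : ℕ) : ℝ)) := by
  unfold wt; simp; ring

/-- Every exponent of a four-letter row has negative `ξ`-weight. -/
theorem wt_row4_neg {z c a b : ℂ} {x : Expo} (hx : x ∈ (row4 z c a b).support) : wt xi2 x < 0 := by
  rcases mem_support_row4 hx with rfl | rfl | rfl | rfl <;> (rw [wt_xi2]; norm_num [zz, z2, ya, xb])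

/-- `ξ = (−10,−1)` is a valid weight for the instance. -/
theorem validWeight_xi2 : ValidWeight tu tv xi2 := by
  refine ⟨fun j e he => ?_, fun j e he => ?_⟩ <;> fin_cases j <;> exact wt_row4_neg (by simpa [tu, tv] using he)

/-- `(8,8)` is the strict `ξ`-top of the tail support: weights `−88 > −95 > −106`. -/
theorem isStrictTop_pp : IsStrictTop xi2 (↑(tailDiff tu tv).support : Set Expo) pp := by
  refine ⟨by exact_mod_cast pp_mem_support, fun μ hμ hne => ?_⟩
  rcases mem_support_tailDiff (by exact_mod_cast hμ) with rfl | rfl | rfl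
  · exact absurd rfl hne
  · rw [wt_xi2, wt_xi2]; norm_num [e95, pp, et]
  · rw [wt_xi2, wt_xi2]; norm_num [e106, pp, et]

/-- `p = (8,8)` is LL-visible. -/
theorem pp_mem_llVisible : pp ∈ llVisible tu tv :=
  ⟨xi2, by simp, by simp, validWeight_xi2, isStrictTop_pp⟩

/-- Truncation to the 3-digit box `[0,8)²` does not change a four-letter row (all letters are `< 8`). -/
theorem boxTrunc_row4 (z c a b : ℂ) : boxTrunc 8 8 (row4 z c a b) = row4 z c a b := by
  ext x
  rw [coeff_boxTrunc]
  by_cases hx : x ∈ (row4 z c a b).support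
  · rcases mem_support_row4 hx with rfl | rfl | rfl | rfl <;> simp [zz, z2, ya, xb]
  · rw [notMem_support_iff.1 hx]; simp

/-- Truncated `u`-rows = the `u`-rows. -/
theorem boxTrunc_tu : (fun j => boxTrunc 8 8 (tu j)) = tu := by
  funext j; fin_cases j <;> simp [tu, boxTrunc_row4]

/-- Truncated `v`-rows = the `v`-rows. -/
theorem boxTrunc_tv : (fun j => boxTrunc 8 8 (tv j)) = tv := by
  funext j; fin_cases j <;> simp [tv, boxTrunc_row4]

/-- `u₁ = A − Z − 2B` is not a `v`-row (the functional `coeff Z + coeff B` is `−3` on it, and `−4, −1, −1` on the `v`-rows). -/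
theorem tu0_notMem : ∀ j, tv j ≠ tu 0 := by
  intro j hj
  have hc := congrArg (fun q => coeff zz q + coeff xb q) hj
  fin_cases j <;> norm_num [tu, tv] at hc

/-- The truncated rows of the two sides are NOT equal as multisets (box-coincidence fails at `p`). -/
theorem truncated_rows_ne :
    (Finset.univ.val.map fun j => boxTrunc 8 8 (tu j)) ≠ (Finset.univ.val.map fun j => boxTrunc 8 8 (tv j)) := by
  rw [boxTrunc_tu, boxTrunc_tv]
  intro h
  have hmem : tu 0 ∈ (Finset.univ.val.map tv) := by
    rw [← h]; exact Multiset.mem_map.2 ⟨0, Finset.mem_univ_val 0, rfl⟩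
  obtain ⟨j, -, hj⟩ := Multiset.mem_map.1 hmem
  exact tu0_notMem j hj

/-- The half letter `T = (4,4) = p/2` has coefficient `0` in every row. -/
theorem coeff_et_rows : ∀ j, coeff et (tu j) = 0 ∧ coeff et (tv j) = 0 := by
  intro j; fin_cases j <;> simp [tu, tv]

/-- The half letter `T = p/2` is NOT a tail letter of the instance. -/
theorem halfLetter_notMem_tailSupport : et ∉ tailSupport tu tv := by
  intro h
  unfold tailSupport at h
  rcases Finset.mem_union.1 h with h | h <;> obtain ⟨j, -, hj⟩ := Finset.mem_biUnion.1 h <;>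
    rw [mem_support_iff] at hj
  · exact hj (coeff_et_rows j).1
  · exact hj (coeff_et_rows j).2

/-- `p = (8,8) = T + T`. -/
theorem pp_eq : pp = et + et := rfl

/-- `pp₀ = 8`. -/
theorem pp_zero : pp 0 = 8 := by simp [pp]
/-- `pp₁ = 8`. -/
theorem pp_one : pp 1 = 8 := by simp [pp]

/-- `A ∈ A_4`. -/
theorem ya_mem_digitGrid : ya ∈ DigitGrid 4 := ⟨1, 2, by norm_num, by norm_num, by simp [ya], by simp [ya]⟩
/-- `B ∈ A_4`. -/
theorem xb_mem_digitGrid : xb ∈ DigitGrid 4 := ⟨2, 1, by norm_num, by norm_num, by simp [xb], by simp [xb]⟩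
/-- `Z ∈ A_4`. -/
theorem zz_mem_digitGrid : zz ∈ DigitGrid 4 := ⟨0, 0, by norm_num, by norm_num, by simp [zz], by simp [zz]⟩
/-- `U ∈ A_4`. -/
theorem z2_mem_digitGrid : z2 ∈ DigitGrid 4 := ⟨1, 1, by norm_num, by norm_num, by simp [z2], by simp [z2]⟩

/-- Rows are supported on the digit grid `A_4`. -/
theorem row4_support_digitGrid {z c a b : ℂ} : ∀ e ∈ (row4 z c a b).support, e ∈ DigitGrid 4 := by
  intro e he
  rcases mem_support_row4 he with rfl | rfl | rfl | rfl
  exacts [zz_mem_digitGrid, z2_mem_digitGrid, ya_mem_digitGrid, xb_mem_digitGrid]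

/-- `u` is supported on `A_4`. -/
theorem tu_digitGrid : ∀ j, ∀ e ∈ (tu j).support, e ∈ DigitGrid 4 := by
  intro j; fin_cases j <;> exact row4_support_digitGrid

/-- `v` is supported on `A_4`. -/
theorem tv_digitGrid : ∀ j, ∀ e ∈ (tv j).support, e ∈ DigitGrid 4 := by
  intro j; fin_cases j <;> exact row4_support_digitGrid

/-- **The witness, packaged:** digit-grid rows (`s = 4`, `m = 3`, every row `1 +` three letters, no `T`), an LL-visible
digit corner `p = (8,8) = T + T` at which box-coincidence FAILS, and the half letter `T` in no row. -/
theorem noHalfLetter_witness :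
    (∀ j, ∀ e ∈ (tu j).support, e ∈ DigitGrid 4) ∧ (∀ j, ∀ e ∈ (tv j).support, e ∈ DigitGrid 4) ∧
    pp ∈ llVisible tu tv ∧ pp = et + et ∧
    (Finset.univ.val.map fun j => boxTrunc (pp 0) (pp 1) (tu j)) ≠
      (Finset.univ.val.map fun j => boxTrunc (pp 0) (pp 1) (tv j)) ∧
    et ∉ tailSupport tu tv := by
  refine ⟨tu_digitGrid, tv_digitGrid, pp_mem_llVisible, pp_eq, ?_, halfLetter_notMem_tailSupport⟩
  rw [pp_zero, pp_one]; exact truncated_rows_ne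

/-- **The half-letter charging law is false (from `m = 3` on):** it is NOT true that at every LL-visible point `p = h + h`
of a digit-grid instance where the rows truncated below `p` differ as multisets (an «exceptional box»), the half letter
`h` occurs in some row. (For `m = 2` and `p = (8,8)` it does hold, by parity of digits.) -/
theorem not_halfLetter_of_exceptional_corner :
    ¬ (∀ (m s : ℕ) (u v : Fin m → MvPolynomial (Fin 2) ℂ),
        (∀ j, ∀ e ∈ (u j).support, e ∈ DigitGrid s) → (∀ j, ∀ e ∈ (v j).support, e ∈ DigitGrid s) →
        ∀ p ∈ llVisible u v, ∀ h : Expo, p = h + h →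
          (Finset.univ.val.map fun j => boxTrunc (p 0) (p 1) (u j)) ≠
            (Finset.univ.val.map fun j => boxTrunc (p 0) (p 1) (v j)) →
          h ∈ tailSupport u v) := by
  intro H
  obtain ⟨hu, hv, hvis, hpp, hne, hnot⟩ := noHalfLetter_witness
  exact hnot (H 3 4 tu tv hu hv pp hvis et hpp hne)

end

end Summit.ValiantsHypothesis.ValiantsHypothesis.Theorems.NewtonUnitEquations.TwoProducts.Negative.NoHalfLetter
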